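import Mathlib
import Summits.NavierStokesRegularity.NavierStokesRegularity.Theorems.EulerZoomLiouvillePowerGaugeEulerLiouvilleHoopFrame

/-!
# Hoop core — the atom-subtracted hoop density is `O(1/t)` at the axis

Sub-problem `NavierStokesRegularity`, crux `PowerGaugeEulerLiouville` (a crux CLASS of self-similar Euler/NS strata — not NS
regularity).  For `V ∈ C¹` and `R > 0` there is `C` with `t · |hoopDensity V (axisPt s t θ)| ≤ C` whenever `t > 0` and
`axisPt s t θ ∈ B̄(0, R)` — the integrability input of the cylindrical Tonelli/Bochner formulas for `∫_{solidCyl} hoopDensity V`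
(K-HOOP assembly (c); `C = 4 · sup_{B̄_R} ‖V‖ · sup_{B̄_R} ‖DV‖`: the atom subtraction turns `V_r² − (v·ê_r)²` into
`⟪V(y) − V(s e_z), ê_r⟫ · ⟪V(y) + V(s e_z), ê_r⟫`, and `‖V(y) − V(s e_z)‖ ≤ sup‖DV‖ · t` by the mean value inequality on the ball).
-/

noncomputable section

set_option linter.dupNamespace false

open Set Function WithLp Metric
open scoped InnerProductSpace RealInnerProductSpace

namespace Summit.NavierStokesRegularity.NavierStokesRegularity.Theorems.PowerGaugeEulerLiouville.HoopCore

open Literature.Analysis Literature.Analysis.FluidPDE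

/-- The circle point splits as axis point plus `t` times the radial frame vector: `axisPt s t θ = s•e_z + t•R_θ e₀`. [folklore] -/
theorem axisPt_eq_axis_add (s t θ : ℝ) :
    axisPt s t θ = s • eZ + t • rotZ θ (EuclideanSpace.single (0 : Fin 3) (1 : ℝ)) := by
  rw [axisPt_eq]
  ext i
  fin_cases i <;> simp [eZ, rotZ, mul_comm]

/-- The rotated `e₀` is a unit vector. [folklore] -/
theorem norm_rotZ_single_zero (θ : ℝ) : ‖rotZ θ (EuclideanSpace.single (0 : Fin 3) (1 : ℝ))‖ = 1 := by
  rw [← rotZLIE_apply, LinearIsometryEquiv.norm_map]; simp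

/-- The rotated `e₁` is a unit vector. [folklore] -/
theorem norm_rotZ_single_one (θ : ℝ) : ‖rotZ θ (EuclideanSpace.single (1 : Fin 3) (1 : ℝ))‖ = 1 := by
  rw [← rotZLIE_apply, LinearIsometryEquiv.norm_map]; simp

/-- Distance from the circle point to the axis point at the same height: `‖axisPt s t θ − s•e_z‖ = t` (`t ≥ 0`). [folklore] -/
theorem norm_axisPt_sub_axis (s : ℝ) {t : ℝ} (ht : 0 ≤ t) (θ : ℝ) : ‖axisPt s t θ - s • eZ‖ = t := by
  rw [axisPt_eq_axis_add, add_sub_cancel_left, norm_smul, norm_rotZ_single_zero, mul_one, Real.norm_of_nonneg ht]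

/-- `‖axisPt s t θ‖² = t² + s²`. [folklore] -/
theorem norm_sq_axisPt (s t θ : ℝ) : ‖axisPt s t θ‖ ^ 2 = t ^ 2 + s ^ 2 := by
  obtain ⟨h0, h1, h2⟩ := axisPt_apply s t θ
  rw [EuclideanSpace.norm_sq_eq, Fin.sum_univ_three, h0, h1, h2]
  simp only [Real.norm_eq_abs, sq_abs]
  linear_combination t ^ 2 * Real.cos_sq_add_sin_sq θ

/-- The axis point at the same height is no farther from the origin: `‖s•e_z‖ ≤ ‖axisPt s t θ‖`. [folklore] -/
theorem norm_axis_le_norm_axisPt (s t θ : ℝ) : ‖s • eZ‖ ≤ ‖axisPt s t θ‖ := by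
  have h1 : ‖s • eZ‖ = |s| := by
    rw [norm_smul, Real.norm_eq_abs]; simp [eZ]
  rw [h1]
  exact (abs_le_of_sq_le_sq' (by rw [sq_abs, norm_sq_axisPt]; nlinarith [sq_nonneg t]) (norm_nonneg _)).2

/-- **THE HOOP DENSITY IS `O(1/t)` AT THE AXIS.**  `V ∈ C¹`, `R > 0` ⇒ there is `C` (namely `4·sup_{B̄_R}‖V‖·sup_{B̄_R}‖DV‖`) with
`t · |hoopDensity V (axisPt s t θ)| ≤ C` for all `s, θ` and `t > 0` with `axisPt s t θ ∈ B̄(0,R)`.  (Atom subtraction: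
`V_r² − (v·ê_r)² = ⟪V(y) − v, ê_r⟫⟪V(y) + v, ê_r⟫`, `v = V(s e_z)`, `|⟪V(y) − v, ê_r⟫| ≤ ‖V(y) − v‖ ≤ sup‖DV‖ · t` by the mean value
inequality on the convex ball, `|⟪V(y) + v, ê_r⟫| ≤ 2 sup‖V‖`; same for `ê_θ`.)  The integrability input for `∫_{solidCyl} hoopDensity`.
[folklore] -/
theorem exists_mul_abs_hoopDensity_le {V : EuclideanSpace ℝ (Fin 3) → EuclideanSpace ℝ (Fin 3)} (hV : ContDiff ℝ 1 V)
    {R : ℝ} (hR : 0 < R) :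
    ∃ C : ℝ, ∀ s t θ : ℝ, 0 < t → axisPt s t θ ∈ closedBall (0 : EuclideanSpace ℝ (Fin 3)) R →
      t * |hoopDensity V (axisPt s t θ)| ≤ C := by
  -- sup bounds of `V` and `DV` on the ball
  obtain ⟨K, hK⟩ := (isCompact_closedBall (0 : EuclideanSpace ℝ (Fin 3)) R).exists_bound_of_continuousOn
    hV.continuous.continuousOn
  obtain ⟨M, hM⟩ := (isCompact_closedBall (0 : EuclideanSpace ℝ (Fin 3)) R).exists_bound_of_continuousOn
    (hV.continuous_fderiv one_ne_zero).continuousOn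
  have hK0 : 0 ≤ K := (norm_nonneg _).trans (hK 0 (mem_closedBall_self hR.le))
  have hM0 : 0 ≤ M := (norm_nonneg _).trans (hM 0 (mem_closedBall_self hR.le))
  refine ⟨4 * K * M, fun s t θ ht hy => ?_⟩
  set y := axisPt s t θ with hydef
  -- the axis point at the same height lies in the ball
  have hA : s • eZ ∈ closedBall (0 : EuclideanSpace ℝ (Fin 3)) R := by
    rw [mem_closedBall, dist_zero_right] at hy ⊢
    exact (norm_axis_le_norm_axisPt s t θ).trans hy
  -- mean value inequality on the convex ball
  have hmv : ‖V y - V (s • eZ)‖ ≤ M * t := by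
    have h := (convex_closedBall (0 : EuclideanSpace ℝ (Fin 3)) R).norm_image_sub_le_of_norm_fderiv_le
      (fun x _ => (hV.differentiable one_ne_zero) x) hM hA hy
    rwa [norm_axisPt_sub_axis s ht.le θ] at h
  -- unit frame vectors
  have heR : ‖eR y‖ = 1 := by rw [hydef, eR_axisPt s ht θ, norm_rotZ_single_zero]
  have heT : ‖eTheta y‖ = 1 := by rw [hydef, eTheta_axisPt s ht θ, norm_rotZ_single_one]
  have hy2 : y 2 = s := (axisPt_apply s t θ).2.2
  have hr : cylRadius y = t := cylRadius_axisPt s ht.le θ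
  -- the four elementary bounds
  have hVy : ‖V y‖ ≤ K := hK y hy
  have hVA : ‖V (s • eZ)‖ ≤ K := hK _ hA
  have d1 : |⟪V y - V (s • eZ), eR y⟫| ≤ M * t :=
    (abs_real_inner_le_norm _ _).trans (by rw [heR, mul_one]; exact hmv)
  have d2 : |⟪V y - V (s • eZ), eTheta y⟫| ≤ M * t :=
    (abs_real_inner_le_norm _ _).trans (by rw [heT, mul_one]; exact hmv)
  have s1 : |⟪V y + V (s • eZ), eR y⟫| ≤ 2 * K :=
    (abs_real_inner_le_norm _ _).trans (by
      rw [heR, mul_one]; exact (norm_add_le _ _).trans (by linarith))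
  have s2 : |⟪V y + V (s • eZ), eTheta y⟫| ≤ 2 * K :=
    (abs_real_inner_le_norm _ _).trans (by
      rw [heT, mul_one]; exact (norm_add_le _ _).trans (by linarith))
  -- the numerator
  have hnum : |radialVelocity V y ^ 2 - swirlVelocity V y ^ 2 -
      (⟪V ((y 2) • eZ), eR y⟫ ^ 2 - ⟪V ((y 2) • eZ), eTheta y⟫ ^ 2)| ≤ 4 * K * M * t := by
    rw [hy2, radialVelocity, swirlVelocity,
      show ⟪V y, eR y⟫ ^ 2 - ⟪V y, eTheta y⟫ ^ 2 - (⟪V (s • eZ), eR y⟫ ^ 2 - ⟪V (s • eZ), eTheta y⟫ ^ 2) =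
        ⟪V y - V (s • eZ), eR y⟫ * ⟪V y + V (s • eZ), eR y⟫ -
          ⟪V y - V (s • eZ), eTheta y⟫ * ⟪V y + V (s • eZ), eTheta y⟫ by
        simp only [inner_sub_left, inner_add_left]; ring]
    refine (abs_sub _ _).trans ?_
    rw [abs_mul, abs_mul]
    have e1 : |⟪V y - V (s • eZ), eR y⟫| * |⟪V y + V (s • eZ), eR y⟫| ≤ M * t * (2 * K) :=
      mul_le_mul d1 s1 (abs_nonneg _) (by positivity)
    have e2 : |⟪V y - V (s • eZ), eTheta y⟫| * |⟪V y + V (s • eZ), eTheta y⟫| ≤ M * t * (2 * K) :=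
      mul_le_mul d2 s2 (abs_nonneg _) (by positivity)
    linarith
  -- conclusion
  rw [hoopDensity, hr, abs_div, abs_of_pos (pow_pos ht 2)]
  rw [show t * (|radialVelocity V y ^ 2 - swirlVelocity V y ^ 2 -
      (⟪V ((y 2) • eZ), eR y⟫ ^ 2 - ⟪V ((y 2) • eZ), eTheta y⟫ ^ 2)| / t ^ 2) =
      |radialVelocity V y ^ 2 - swirlVelocity V y ^ 2 -
        (⟪V ((y 2) • eZ), eR y⟫ ^ 2 - ⟪V ((y 2) • eZ), eTheta y⟫ ^ 2)| / t by
    field_simp]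
  rw [div_le_iff₀ ht]
  exact hnum

/-- Corollary on the solid cylinder: `solidCyl s₁ s₂ T₀ ⊆ B̄(0, R)` for `R = √(max (s₁²) (s₂²) + T₀²)`… stated in the form the
Tonelli criterion consumes: a uniform bound `t · |hoopDensity V (axisPt s t θ)| ≤ C` over `s ∈ [s₁, s₂]`, `0 < t ≤ T₀`. [folklore] -/
theorem exists_mul_abs_hoopDensity_le_solidCyl {V : EuclideanSpace ℝ (Fin 3) → EuclideanSpace ℝ (Fin 3)}
    (hV : ContDiff ℝ 1 V) (s₁ s₂ : ℝ) {T₀ : ℝ} (hT₀ : 0 < T₀) :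
    ∃ C : ℝ, ∀ s t θ : ℝ, s₁ ≤ s → s ≤ s₂ → 0 < t → t ≤ T₀ →
      t * |hoopDensity V (axisPt s t θ)| ≤ C := by
  set R : ℝ := |s₁| + |s₂| + T₀ with hRdef
  have hR : 0 < R := by rw [hRdef]; positivity
  obtain ⟨C, hC⟩ := exists_mul_abs_hoopDensity_le hV hR
  refine ⟨C, fun s t θ hs1 hs2 ht htT => hC s t θ ht ?_⟩
  rw [mem_closedBall, dist_zero_right]
  have hs : |s| ≤ |s₁| + |s₂| := by
    rcases le_or_gt 0 s with h | h
    · rw [abs_of_nonneg h]; linarith [le_abs_self s₂, abs_nonneg s₁]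
    · rw [abs_of_neg h]; linarith [neg_le_abs s₁, abs_nonneg s₂]
  have h2 : ‖axisPt s t θ‖ ^ 2 ≤ R ^ 2 := by
    rw [norm_sq_axisPt, hRdef]
    nlinarith [abs_nonneg s₁, abs_nonneg s₂, sq_abs s, abs_nonneg s]
  exact abs_le_of_sq_le_sq' h2 hR.le |>.2 |> fun h => (le_abs_self _).trans (by
    rw [abs_of_nonneg (norm_nonneg _)]; exact h)

/-! ### Circle integrals: the axis atom averages to zero -/

/-- Coordinates of the real inner product on `ℝ³`. [folklore] -/
theorem real_inner_eq_sum_three (x y : EuclideanSpace ℝ (Fin 3)) : ⟪x, y⟫ = x 0 * y 0 + x 1 * y 1 + x 2 * y 2 := by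
  simp only [PiLp.inner_apply, Fin.sum_univ_three, RCLike.inner_apply, conj_trivial]
  ring

/-- `⟪v, ê_r⟫ = v₀ cos θ + v₁ sin θ` on the circle (`t > 0`). [folklore] -/
theorem inner_eR_axisPt (v : EuclideanSpace ℝ (Fin 3)) (s : ℝ) {t : ℝ} (ht : 0 < t) (θ : ℝ) :
    ⟪v, eR (axisPt s t θ)⟫ = v 0 * Real.cos θ + v 1 * Real.sin θ := by
  rw [eR_axisPt s ht θ, real_inner_eq_sum_three]
  simp [rotZ]

/-- `⟪v, ê_θ⟫ = −v₀ sin θ + v₁ cos θ` on the circle (`t > 0`). [folklore] -/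
theorem inner_eTheta_axisPt (v : EuclideanSpace ℝ (Fin 3)) (s : ℝ) {t : ℝ} (ht : 0 < t) (θ : ℝ) :
    ⟪v, eTheta (axisPt s t θ)⟫ = -(v 0 * Real.sin θ) + v 1 * Real.cos θ := by
  rw [eTheta_axisPt s ht θ, real_inner_eq_sum_three]
  simp [rotZ]

/-- The circle point depends continuously on the angle (local copy; the tree's public version is
`HoopCore.continuous_axisPt` of `…HoopCylinder`). [folklore] -/
private theorem continuous_axisPt_angle (s t : ℝ) : Continuous fun θ : ℝ => axisPt s t θ := by
  simp only [axisPt_eq]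
  fun_prop

/-- The radial frame vector moves continuously along the circle (`t > 0`). [folklore] -/
theorem continuous_eR_axisPt (s : ℝ) {t : ℝ} (ht : 0 < t) : Continuous fun θ : ℝ => eR (axisPt s t θ) := by
  have e : (fun θ : ℝ => eR (axisPt s t θ)) = fun θ => Real.cos θ • EuclideanSpace.single (0 : Fin 3) (1 : ℝ) +
      Real.sin θ • EuclideanSpace.single (1 : Fin 3) (1 : ℝ) := by
    funext θ
    rw [eR_axisPt s ht θ]
    ext i
    fin_cases i <;> simp [rotZ]
  rw [e]
  fun_prop

/-- The angular frame vector moves continuously along the circle (`t > 0`). [folklore] -/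
theorem continuous_eTheta_axisPt (s : ℝ) {t : ℝ} (ht : 0 < t) : Continuous fun θ : ℝ => eTheta (axisPt s t θ) := by
  have e : (fun θ : ℝ => eTheta (axisPt s t θ)) = fun θ => -Real.sin θ • EuclideanSpace.single (0 : Fin 3) (1 : ℝ) +
      Real.cos θ • EuclideanSpace.single (1 : Fin 3) (1 : ℝ) := by
    funext θ
    rw [eTheta_axisPt s ht θ]
    ext i
    fin_cases i <;> simp [rotZ]
  rw [e]
  fun_prop

/-- **THE AXIS ATOM AVERAGES TO ZERO ON EVERY CIRCLE**: for a fixed vector `v` (the axis velocity),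
`∫₀^{2π} (⟪v, ê_r⟫² − ⟪v, ê_θ⟫²) dθ = 0` (the integrand is `(v₀² − v₁²) cos 2θ + 2v₀v₁ sin 2θ`). [folklore] -/
theorem intervalIntegral_atom_eq_zero (v : EuclideanSpace ℝ (Fin 3)) (s : ℝ) {t : ℝ} (ht : 0 < t) :
    ∫ θ in (0 : ℝ)..2 * Real.pi, (⟪v, eR (axisPt s t θ)⟫ ^ 2 - ⟪v, eTheta (axisPt s t θ)⟫ ^ 2) = 0 := by
  have hF : ∀ θ : ℝ, HasDerivAt (fun θ => (v 0 ^ 2 - v 1 ^ 2) * (Real.sin θ * Real.cos θ) +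
      2 * v 0 * v 1 * Real.sin θ ^ 2)
      (⟪v, eR (axisPt s t θ)⟫ ^ 2 - ⟪v, eTheta (axisPt s t θ)⟫ ^ 2) θ := by
    intro θ
    rw [inner_eR_axisPt v s ht, inner_eTheta_axisPt v s ht]
    have h1 := ((Real.hasDerivAt_sin θ).mul (Real.hasDerivAt_cos θ)).const_mul (v 0 ^ 2 - v 1 ^ 2)
    have h2 := ((Real.hasDerivAt_sin θ).pow 2).const_mul (2 * v 0 * v 1)
    refine (h1.add h2).congr_deriv ?_
    push_cast
    ring
  have hc : Continuous fun θ : ℝ => ⟪v, eR (axisPt s t θ)⟫ ^ 2 - ⟪v, eTheta (axisPt s t θ)⟫ ^ 2 :=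
    ((continuous_const.inner (continuous_eR_axisPt s ht)).pow 2).sub
      ((continuous_const.inner (continuous_eTheta_axisPt s ht)).pow 2)
  rw [intervalIntegral.integral_eq_sub_of_hasDerivAt (fun θ _ => hF θ) (hc.intervalIntegrable _ _)]
  simp [Real.sin_two_pi]

/-- **CIRCLE INTEGRAL OF THE HOOP DENSITY**: for continuous `V` and `t > 0`,
`∫₀^{2π} hoopDensity V (axisPt s t θ) dθ = t^{−2} ∫₀^{2π} (V_r² − V_θ²)(axisPt s t θ) dθ` — the atom subtraction is invisible after
the azimuthal integration. [folklore] -/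
theorem intervalIntegral_hoopDensity_axisPt {V : EuclideanSpace ℝ (Fin 3) → EuclideanSpace ℝ (Fin 3)} (hV : Continuous V)
    (s : ℝ) {t : ℝ} (ht : 0 < t) :
    ∫ θ in (0 : ℝ)..2 * Real.pi, hoopDensity V (axisPt s t θ) =
      (∫ θ in (0 : ℝ)..2 * Real.pi,
        (radialVelocity V (axisPt s t θ) ^ 2 - swirlVelocity V (axisPt s t θ) ^ 2)) / t ^ 2 := by
  have hr : ∀ θ, cylRadius (axisPt s t θ) = t := fun θ => cylRadius_axisPt s ht.le θ
  have h2 : ∀ θ, axisPt s t θ 2 = s := fun θ => (axisPt_apply s t θ).2.2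
  have heR : Continuous fun θ : ℝ => eR (axisPt s t θ) := continuous_eR_axisPt s ht
  have heT : Continuous fun θ : ℝ => eTheta (axisPt s t θ) := continuous_eTheta_axisPt s ht
  have hVc : Continuous fun θ : ℝ => V (axisPt s t θ) := hV.comp (continuous_axisPt_angle s t)
  have hA : IntervalIntegrable (fun θ => radialVelocity V (axisPt s t θ) ^ 2 - swirlVelocity V (axisPt s t θ) ^ 2)
      MeasureTheory.volume 0 (2 * Real.pi) := by
    refine Continuous.intervalIntegrable ?_ _ _
    simp only [radialVelocity, swirlVelocity]
    exact ((hVc.inner heR).pow 2).sub ((hVc.inner heT).pow 2)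
  have hB : IntervalIntegrable (fun θ => ⟪V (s • eZ), eR (axisPt s t θ)⟫ ^ 2 - ⟪V (s • eZ), eTheta (axisPt s t θ)⟫ ^ 2)
      MeasureTheory.volume 0 (2 * Real.pi) :=
    (((continuous_const.inner heR).pow 2).sub ((continuous_const.inner heT).pow 2)).intervalIntegrable _ _
  have e : (fun θ => hoopDensity V (axisPt s t θ)) = fun θ =>
      ((radialVelocity V (axisPt s t θ) ^ 2 - swirlVelocity V (axisPt s t θ) ^ 2) -
        (⟪V (s • eZ), eR (axisPt s t θ)⟫ ^ 2 - ⟪V (s • eZ), eTheta (axisPt s t θ)⟫ ^ 2)) / t ^ 2 := by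
    funext θ
    rw [hoopDensity, hr θ, h2 θ]
  rw [e, intervalIntegral.integral_div, intervalIntegral.integral_sub hA hB, intervalIntegral_atom_eq_zero _ s ht,
    sub_zero]

end Summit.NavierStokesRegularity.NavierStokesRegularity.Theorems.PowerGaugeEulerLiouville.HoopCore

end
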